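import Summits.ResolutionOfSingularities.ResolutionOfSingularities.Theorems.MarkedTransferCampaignW25FiniteABRay
import Literature.AlgebraicGeometry.Hironaka2017.Proofs.S09LLUED.FiniteRayDepth
import Literature.AlgebraicGeometry.Hironaka2017.Proofs.S09LLUED.Lem95Coupled
import HarnessLib

/-!
# [OURS · L W2.5 = L-47B-s3] The two CLOSED statements of `MarkedTransferCampaignW25FiniteABRay.lean` HOLD:
# `CampaignW25.FiniteRayDepthChoice p` and `CampaignW25.FiniteRayLem95Coupled p` for every prime `p`

HONEST FRAMING. Kernel proofs of OUR campaign statements (cell `res-hironaka`, slot W2.5, statement file p502315 by the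
slot's statement typer res-type-054): «Lemma 9.5 (B) restricted to (uniformly) finite AB-rays». They are theorems about
OUR typed objects (rows 052/054/055c carriers); nothing of H. Hironaka's manuscript [Hironaka2017] is asserted, and no
GAP-LEDGER word is implied (the G2 lead res-adj-2 words R47 (B)). The work is done in the Literature-side kernel annex
`Proofs/S09LLUED/FiniteRayDepth.lean` (`FiniteRayDepth.depthIneq_eventually_of_uniformlyFiniteRay`: rebuild the top
block of any standard expression from the finitely many ray monomials with constant unit coefficients) and in
res-type-055's reduction `Lem9_5_cpl_R3_inst_iff_depthIneq` / `Lem9_5_cpl_R2_inst_iff_depthIneq` (p487776); this file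
only unfolds the definitions `ray` / `rayOf` / `UniformlyFiniteRay`. AI review is weaker than expert review.
-/

set_option linter.dupNamespace false -- mandated namespace of this single-conjunct summit

namespace Summit.ResolutionOfSingularities.ResolutionOfSingularities.Theorems

namespace CampaignW25

open Literature.AlgebraicGeometry.Hironaka2017.S09LLUED
open Literature.AlgebraicGeometry.Hironaka2017.S09LLUED.FiniteRayDepth

/-- [OURS · L W2.5 / L-47B-s3] **`FiniteRayDepthChoice p` holds for every prime `p`**: a uniformly finite ray (plus
existence of standard expressions at large depths) makes the printed depth inequality `ℓ > |α + pβ + qγ₀|` (row 055c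
`DepthIneq`, Lemma 9.5 p.50 l.11–12 in the COUPLED reading) satisfiable by SOME standard expression at every large depth.
Proof: `FiniteRayDepth.depthIneq_eventually_of_uniformlyFiniteRay` after unfolding `UniformlyFiniteRay` / `rayOf` /
`ray`. Not a statement of the manuscript; not a verdict. [folklore] -/
theorem finiteRayDepthChoice_holds (p : ℕ) [Fact p.Prime] : FiniteRayDepthChoice p := by
  intro K _ _ n e he epsSharp hray hX
  obtain ⟨F, ℓ₁, hF⟩ := hray
  obtain ⟨ℓ₂, hX⟩ := hX
  refine depthIneq_eventually_of_uniformlyFiniteRay he epsSharp F ℓ₁ (fun ℓ hℓ X c hc => ?_) ℓ₂ hX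
  exact Finset.mem_coe.1 (hF ℓ hℓ X hc)

/-- [OURS · L W2.5 / L-47B-s3] **`FiniteRayLem95Coupled p` holds for every prime `p`**: at every §7.5 carrier whose
g-cleaning family `ℓ ↦ toFin ε♯(ℓ)` has a uniformly finite ray and standard expressions at large depths, the COUPLED
Lemma 9.5 holds in readings R2 and R3 (`Lem9_5_cpl_R2_inst`, `Lem9_5_cpl_R3_inst`, row 055c p486252). Proof:
`finiteRayDepthChoice_holds` + res-type-055's `Lem9_5_cpl_R3_inst_iff_depthIneq` / `Lem9_5_cpl_R2_inst_iff_R3_inst`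
(p487776); `CharP K p` is obtained from `ExpChar K p` since `p` is prime. Not a statement of the manuscript; not a
verdict. [folklore] -/
theorem finiteRayLem95Coupled_holds (p : ℕ) [Fact p.Prime] : FiniteRayLem95Coupled p := by
  intro 𝕂 _ _ _ O _ _ _ K _ _ _ _ _ S σ lifts hray hX
  have hchar : CharP K p := by
    cases ‹ExpChar K p› with
    | zero => exact absurd (Fact.out : Nat.Prime 1) Nat.not_prime_one
    | prime hp => infer_instance
  have key := finiteRayDepthChoice_holds p K (S.m + 1) S.e S.e_pos _ hray hX
  have h3 : Lem9_5_cpl_R3_inst S σ lifts := (Lem9_5_cpl_R3_inst_iff_depthIneq S σ lifts).2 fun _ _ => key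
  exact ⟨(Lem9_5_cpl_R2_inst_iff_R3_inst S σ lifts).2 h3, h3⟩

end CampaignW25

end Summit.ResolutionOfSingularities.ResolutionOfSingularities.Theorems
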